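import Summits.BirchSwinnertonDyer.BirchSwinnertonDyer.Theorems.KolyvaginDepthDoorDepthTableRowsIntrinsic1
import Summits.BirchSwinnertonDyer.BirchSwinnertonDyer.Theorems.KolyvaginDepthDoorDepthTableRankTwo389a1TwistBSDQuotient
import HarnessLib

/-!
# Route `KolyvaginDepthDoor`, crux `KolyvaginDepthSupplyKN` (stmt-BirchSwinnertonDyer-22820) —
# DEPTH TABLE v16, CHECK: the v15 row of `389a1` at `(p, d_K) = (5, −7)` is the `(K, p, T) = (ℚ(√−7), 5, T₀)` INSTANCE of the intrinsic row —
# and loses its (γ) dependence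

Helper file of the lead prover of line `levelone` (kdd-p1 g20; `--supports stmt-BirchSwinnertonDyer-22820
--as helper`); it closes nothing and BSD is NOT proved by it.

Non-vacuity / consistency check of the intrinsic form. g19's `C389a1.cruxBody_of_twistBSDQuotient` (`…RankTwo389a1TwistBSDQuotient`) read the row
at `p = 5`, `d_K = −7` on the kernel-certified minimal twist model `T₀ = [0, −1, 1, −114, −302]`, with `ord_5(quotient) ≤ 0`, modulo (γ) +
W. Zhang + Stein–Wuthrich + BCS + GZK. Feeding `C389a1.cruxBody_intrinsic_at` (v16, `…RowsIntrinsic1`) with `p = 5` (certificates `goodOrdinary_5`,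
`hasSurjectiveModNGaloisRep_pow_5`), ANY `K` with `d_K = −7` (Heegner by `heegner_neg7`), `T = T₀` and `C` from `minTwist7_smul_eq` gives:

* `cruxBody_of_twistBSDQuotient_v16` — the same conclusion from the WEAKER datum `ord_5(L'(T₀,1)/(Ω·Reg)) ≤ 1` and WITHOUT (γ): the intrinsic
  supply direction uses W. Zhang's Lemma 8.4 (1) only (the door (γ) is needed for the converse / exact rows, not here).

So every v13–v15 row is an instance of its v16 form; the universally quantified minimal model of v16 is inhabited here by the v15 certificate
(in general by `hasGlobalMinimalModel_rat_holds`). CONDITIONAL on Stein–Wuthrich Thm. 1.1, W. Zhang L8.4 (1) / 9.1, BCS Cor. 1.3.1, GZK by name;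
per curve; BSD is not proved by it.

References: [SteinWuthrich2013] Thm. 1.1; [WZhang2014] L8.4 (1), Thm. 9.1; [BurungaleCastellaSkinner2025] Cor. 1.3.1; [Darmon2004] Thm. 3.22;
[CremonaAlgorithms1997] Table 1 (389a1).
-/

set_option linter.dupNamespace false

noncomputable section

open scoped Classical NumberField

namespace Summit.BirchSwinnertonDyer.BirchSwinnertonDyer.Theorems.KolyvaginDepthDoor

open Literature.NumberTheory.EllipticCurves Literature.NumberTheory.EllipticCurves.ModularForms
  WeierstrassCurve NumberField IsDedekindDomain
open Summit.BirchSwinnertonDyer.BirchSwinnertonDyer.Theorems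
open Summit.BirchSwinnertonDyer.BirchSwinnertonDyer.Rank2Observatory

namespace C389a1

/-- **The v15 row of `389a1` as an instance of the v16 intrinsic row, (γ)-free and with tolerance `1`.** For ANY imaginary quadratic `K` with
`d_K = −7`: IF `ord_{s=1} L(E^{(−7)}, s) = 1` and `ord_5(L'(T₀,1)/(Ω_{T₀}·Reg_{T₀})) ≤ 1` for the minimal twist model `T₀ = [0,−1,1,−114,−302]`, THEN
the clause of `KolyvaginDepthSupplyKN` holds at `389a1` VERBATIM (`cruxBody_intrinsic_at` at `p = 5`, `goodOrdinary_5`, `hasSurjectiveModNGaloisRep_pow_5`,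
`heegner_neg7`, `minTwist7_smul_eq`). CONDITIONAL on SW Thm. 1.1, W. Zhang L8.4 (1) / 9.1, BCS Cor. 1.3.1, GZK by name — NOT on (γ); per curve;
BSD is not proved by it. [cite: SteinWuthrich2013, Thm. 1.1 (p. 1758)] [cite: WZhang2014, Lemma 8.4 (1) (p. 236), Thm. 9.1 (p. 240)]
[cite: BurungaleCastellaSkinner2025, Cor. 1.3.1 (p. 4)] [cite: CremonaAlgorithms1997, Table 1 (389a1)] -/
theorem cruxBody_of_twistBSDQuotient_v16
    (hSW : SteinWuthrich2013_sha_inf_torsionBy_eq_bot_of_two_le_rank)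
    (h84 : Literature.NumberTheory.EllipticCurves.WZhang2014_lemma84_exists_minimal_kolyvaginClass_one_selmerCard)
    (hBCS : BurungaleCastellaSkinner2025.cor131_padicValRat_bsd_rank_le_one)
    (hGZK : rank_eq_analyticRank_of_analyticRank_le_one)
    (K : Type) [Field K] [NumberField K] (hK : IsImaginaryQuadratic K) (hD : NumberField.discr K = -7)
    (hTr : (Curve389a1.E.quadraticTwist (NumberField.discr K : ℚ)).analyticRank = 1)
    (hval : haveI := minTwist7_isElliptic; haveI := minTwist7_isGloballyMinimal;
      ∀ q : ℚ, ((⟨0, -1, 1, -114, -302⟩ : WeierstrassCurve ℤ).map (Int.castRingHom ℚ)).leadingLCoeff /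
          ((((⟨0, -1, 1, -114, -302⟩ : WeierstrassCurve ℤ).map (Int.castRingHom ℚ)).realPeriodRat *
            ((⟨0, -1, 1, -114, -302⟩ : WeierstrassCurve ℤ).map (Int.castRingHom ℚ)).regulator : ℝ) : ℂ) = (q : ℂ) →
        padicValRat 5 q ≤ 1) :
    haveI := curve389a1_isGloballyMinimal;
    ∃ (p : ℕ) (hp : Fact p.Prime), 5 ≤ p ∧ Curve389a1.E.HasGoodReductionAtPrime p ∧
      ¬ (p : ℤ) ∣ Curve389a1.E.frobeniusTrace p ∧ (∀ n : ℕ, Curve389a1.E.HasSurjectiveModNGaloisRep (p ^ n : ℕ)) ∧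
      (∀ v : HeightOneSpectrum (𝓞 ℚ), Curve389a1.E.HasMultiplicativeReductionAt v →
        ¬ p ∣ Curve389a1.E.ordMinimalDiscriminant v) ∧
      ∃ (K : Type) (_ : Field K) (_ : NumberField K), IsImaginaryQuadratic K ∧
        NumberField.discr K ≠ -3 ∧ NumberField.discr K ≠ -4 ∧
        ∃ (_ : NeZero (Curve389a1.E.conductorNorm ℤ)), SatisfiesHeegnerHypothesis (Curve389a1.E.conductorNorm ℤ) K ∧
        ∃ (Dt : ModularParametrizationData Curve389a1.E (Curve389a1.E.conductorNorm ℤ)) (β : ℤ) (ι : K →+* ℂ) (n₁ : ℕ)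
          (d : KolyvaginHeegnerData Dt β ι n₁), Squarefree n₁ ∧
          (∀ q ∈ n₁.primeFactors, Zhang2014.IsKolyvaginPrime (Curve389a1.E.conductorNorm ℤ) Curve389a1.E K p q) ∧
          d.kolyvaginClass hp.out 1 ≠ 0 ∧
          (n₁.primeFactors.card + 1 ≤ Curve389a1.E.mordellWeilRank ∨
            (n₁.primeFactors.card ≤ Curve389a1.E.mordellWeilRank ∧
              n₁.primeFactors.card + 1 ≤ (Curve389a1.E.quadraticTwist (NumberField.discr K : ℚ)).mordellWeilRank)) := by
  haveI := curve389a1_isGloballyMinimal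
  haveI := minTwist7_isElliptic
  haveI := minTwist7_isGloballyMinimal
  haveI iP : Fact (Nat.Prime 5) := ⟨by norm_num⟩
  have hH : SatisfiesHeegnerHypothesis 389 K := by
    have h := satisfiesHeegnerHypothesis_conductorNorm_of_intModel intModel K hK.1 hD heegner_neg7
    rwa [conductorNorm_eq] at h
  have hD3 : NumberField.discr K ≠ -3 := by rw [hD]; norm_num
  have hD4 : NumberField.discr K ≠ -4 := by rw [hD]; norm_num
  have hpD : ¬ (((5 : ℕ) : ℤ) ∣ NumberField.discr K) := by rw [hD]; decide
  have hcast : (NumberField.discr K : ℚ) = ((-7) : ℚ) := by rw [hD]; norm_num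
  have hC : (⟨1, (-2 : ℚ), (0 : ℚ), -((1 : ℚ) / 2)⟩ : WeierstrassCurve.VariableChange ℚ) •
        ((⟨0, -1, 1, -114, -302⟩ : WeierstrassCurve ℤ).map (Int.castRingHom ℚ)) =
      Curve389a1.E.quadraticTwist (NumberField.discr K : ℚ) := by
    rw [hcast]; exact minTwist7_smul_eq
  exact cruxBody_intrinsic_at hSW h84 hBCS hGZK 5 le_rfl (by norm_num) goodOrdinary_5.1 goodOrdinary_5.2
    hasSurjectiveModNGaloisRep_pow_5 K hK hD3 hD4 hpD hH _ _ hC hTr hval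

end C389a1

end Summit.BirchSwinnertonDyer.BirchSwinnertonDyer.Theorems.KolyvaginDepthDoor

end
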